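import Summits.Ventures.PercRepro.S1FiveCircuitsSolidSkeleton

/-!
# PercRepro — THE SOLID ANALYSIS AT NULLITY `5` (PART A): FIBRES, LINES, THE OUTSIDE NULLITY, CLASS (α), THE CONTRACTION (p1, gen 33)

`proofs/P1-S2-CORANK6.md` §4l addendum 4: `ncard_le_mul_ncard_of_fibres`, `ncard_le_three_of_eRk_le_two_of_hfree` (lines through a point of an
e-free core have `≤ 3` points), `encard_le_eRk_add_two_of_inter_singleton` (the nullity outside the 7-point flat is `≤ 2` at nullity `5`),
`ncard_fiveCircuitsThrough_inter_subset_le_five` (class (α) `≤ 5`), `nullity_contract_closure_eq_two` (`ν(M ／ S₀) = 2`). Part B =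
`S1FiveCircuitsSolidCaseOneFive`. Split for the 400-line rule.
Axioms: standard.
-/

open scoped Matroid

namespace PercRepro

namespace S1

open Set

open FourCap

variable {α : Type}

/-- **A fibre count for sets**: if `f` maps `s` into `t` with every fibre of size `≤ n`, then `|s| ≤ n · |t|`
(`Finset.card_le_mul_card_image_of_maps_to`). -/
theorem ncard_le_mul_ncard_of_fibres {β : Type} [DecidableEq β] {s : Set α} {t : Set β} (hs : s.Finite) (ht : t.Finite)
    (f : α → β) (hf : ∀ a ∈ s, f a ∈ t) (n : ℕ) (hn : ∀ b ∈ t, {a ∈ s | f a = b}.ncard ≤ n) :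
    s.ncard ≤ n * t.ncard := by
  classical
  rw [ncard_eq_toFinset_card s hs, ncard_eq_toFinset_card t ht]
  refine Finset.card_le_mul_card_image_of_maps_to (f := f) (fun a ha => ?_) n (fun b hb => ?_)
  · rw [Finite.mem_toFinset] at ha ⊢
    exact hf a ha
  · rw [Finite.mem_toFinset] at hb
    have h := hn b hb
    have hEq : ({a ∈ s | f a = b} : Set α) = ↑(hs.toFinset.filter (fun a => f a = b)) := by
      ext a
      simp [Finite.mem_toFinset]
    rw [hEq, ncard_coe_finset] at h
    exact h

/-- **A line through a point of an e-free core has at most `3` points**: a fourth point gives two points of the line on one side of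
the partition at `e`, whose closure contains `e`. -/
theorem ncard_le_three_of_eRk_le_two_of_hfree (M : Matroid α) [M.Finite]
    (hfree : ∀ e ∈ M.E, ∃ A ⊆ M.E \ {e}, e ∉ M.closure A ∧ e ∉ M.closure ((M.E \ {e}) \ A))
    {L : Set α} (hL : L ⊆ M.E) {e : α} (heL : e ∈ L) (hr : M.eRk L ≤ 2) : L.ncard ≤ 3 := by
  by_contra hbig
  push Not at hbig
  have hLf : L.Finite := M.ground_finite.subset hL
  have heE : e ∈ M.E := hL heL
  obtain ⟨A, _, heA, heB⟩ := hfree e heE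
  -- three points of `L ∖ {e}`
  have h3 : 3 ≤ (L \ {e}).ncard := by
    rw [ncard_sdiff_singleton_of_mem heL]
    omega
  obtain ⟨T, hTL, hT3⟩ := Set.exists_subset_card_eq h3
  obtain ⟨a, b, c, hab, hac, hbc, rfl⟩ := ncard_eq_three.1 hT3
  have haL : a ∈ L \ {e} := hTL (mem_insert _ _)
  have hbL : b ∈ L \ {e} := hTL (mem_insert_of_mem _ (mem_insert _ _))
  have hcL : c ∈ L \ {e} := hTL (mem_insert_of_mem _ (mem_insert_of_mem _ (mem_singleton c)))
  -- `e ∈ cl {p, q}` for two distinct points `p, q` of `L`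
  have hpair : ∀ p q, p ∈ L → q ∈ L → p ≠ q → e ∈ M.closure {p, q} := by
    intro p q hp hq hpq
    have hsub : L ⊆ M.closure {p, q} :=
      subset_closure_of_subset_of_eRk_le M hL (pair_subset hp hq)
        (by rw [(indep_pair_of_hfree M hfree (hL hp) (hL hq) hpq).eRk_eq_encard, encard_pair hpq]; exact hr)
    exact hsub heL
  have hside : ∀ p q, p ∈ L \ {e} → q ∈ L \ {e} → p ≠ q →
      ((p ∈ A ∧ q ∈ A) ∨ (p ∉ A ∧ q ∉ A)) → False := by
    intro p q hp hq hpq h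
    rcases h with ⟨hpA, hqA⟩ | ⟨hpA, hqA⟩
    · exact heA (M.closure_mono (pair_subset hpA hqA) (hpair p q hp.1 hq.1 hpq))
    · exact heB (M.closure_mono (pair_subset (show p ∈ (M.E \ {e}) \ A from ⟨⟨hL hp.1, hp.2⟩, hpA⟩)
        (show q ∈ (M.E \ {e}) \ A from ⟨⟨hL hq.1, hq.2⟩, hqA⟩)) (hpair p q hp.1 hq.1 hpq))
  by_cases haA : a ∈ A <;> by_cases hbA : b ∈ A
  · exact hside a b haL hbL hab (Or.inl ⟨haA, hbA⟩)
  · by_cases hcA : c ∈ A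
    · exact hside a c haL hcL hac (Or.inl ⟨haA, hcA⟩)
    · exact hside b c hbL hcL hbc (Or.inr ⟨hbA, hcA⟩)
  · by_cases hcA : c ∈ A
    · exact hside b c hbL hcL hbc (Or.inl ⟨hbA, hcA⟩)
    · exact hside a c haL hcL hac (Or.inr ⟨haA, hcA⟩)
  · exact hside a b haL hbL hab (Or.inr ⟨haA, hbA⟩)

/-- **The nullity outside a 7-point rank-`4` flat is `≤ 2` at nullity `5`**, in the form: for `R ⊆ E` with `S₀ ∩ R = {e}` (`e` not a
loop) and `S₀ ∪ R = E`, `|R| ≤ r(R) + 2`. -/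
theorem encard_le_eRk_add_two_of_inter_singleton (M : Matroid α) [M.Finite] (hd : M.E.encard = M.eRank + 5)
    {X : Set α} (hX4 : M.eRk X = 4) (h7 : (M.closure X).ncard = 7) {R : Set α} (hR : R ⊆ M.E) {e : α}
    (hinter : M.closure X ∩ R = {e}) (hunion : M.closure X ∪ R = M.E) (he : M.IsNonloop e) :
    R.encard ≤ M.eRk R + 2 := by
  have hS₀E : M.closure X ⊆ M.E := M.closure_subset_ground X
  have hS₀f : (M.closure X).Finite := M.ground_finite.subset hS₀E
  have hS₀3 : (M.closure X).encard = M.eRk (M.closure X) + 3 := by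
    rw [← hS₀f.cast_ncard_eq, h7, M.eRk_closure_eq, hX4]
    norm_num
  have hRf : R.Finite := M.ground_finite.subset hR
  obtain ⟨r, hr⟩ := exists_eRk_eq_coe M R
  have hrle : r ≤ R.ncard := by
    have := M.eRk_le_encard R
    rw [hr, ← hRf.cast_ncard_eq] at this
    exact_mod_cast this
  have hRd : R.encard = M.eRk R + (R.ncard - r : ℕ) := by
    rw [hr, ← hRf.cast_ncard_eq, ← Nat.cast_add]
    congr 1
    omega
  have hc : (M.closure X ∩ R).encard ≤ M.eRk (M.closure X ∩ R) + 0 := by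
    rw [add_zero, hinter, he.indep.eRk_eq_encard]
  have h := eRk_union_add_add_le_encard_add_of_nullity M hS₀E hR hS₀3 hRd hc
  rw [hunion, ← M.eRank_def, hd, Nat.cast_zero, add_zero] at h
  obtain ⟨rE, hrE⟩ := exists_eRk_eq_coe M M.E
  rw [M.eRank_def, hrE] at h
  have h' : rE + 3 + (R.ncard - r) ≤ rE + 5 := by exact_mod_cast h
  rw [hr, ← hRf.cast_ncard_eq]
  have : R.ncard ≤ r + 2 := by omega
  exact_mod_cast this

/-- **CLASS (α)**: the five-circuits through `e` meeting the 7-point flat `S₀` only in `e` number at most `5` — they are five-circuits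
through `e` of the restriction to `(E ∖ S₀) ∪ {e}`, a matroid of nullity `≤ 2`. -/
theorem ncard_fiveCircuitsThrough_inter_subset_le_five (M : Matroid α) [M.Finite]
    (hfree : ∀ e ∈ M.E, ∃ A ⊆ M.E \ {e}, e ∉ M.closure A ∧ e ∉ M.closure ((M.E \ {e}) \ A))
    (hd : M.E.encard = M.eRank + 5) {X : Set α} (hX4 : M.eRk X = 4) {e : α} (heX : e ∈ M.closure X)
    (h7 : (M.closure X).ncard = 7) :
    {C : Set α | M.IsCircuit C ∧ C.ncard = 5 ∧ e ∈ C ∧ C ∩ M.closure X ⊆ {e}}.ncard ≤ 5 := by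
  classical
  have hS₀E : M.closure X ⊆ M.E := M.closure_subset_ground X
  have heE : e ∈ M.E := hS₀E heX
  have hel : ¬ M.IsLoop e := by
    intro hl
    obtain ⟨A, _, heA, _⟩ := hfree e heE
    exact heA (M.closure_mono (empty_subset A) hl)
  have henl : M.IsNonloop e := ⟨hel, heE⟩
  set R : Set α := insert e (M.E \ M.closure X) with hRdef
  have hR : R ⊆ M.E := insert_subset heE sdiff_subset
  have hRf : R.Finite := M.ground_finite.subset hR
  have hinter : M.closure X ∩ R = {e} := by
    ext x
    simp only [hRdef, mem_inter_iff, mem_insert_iff, mem_sdiff, mem_singleton_iff]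
    constructor
    · rintro ⟨hx, hx' | ⟨_, hx'⟩⟩
      · exact hx'
      · exact absurd hx hx'
    · rintro rfl
      exact ⟨heX, Or.inl rfl⟩
  have hunion : M.closure X ∪ R = M.E := by
    ext x
    simp only [hRdef, mem_union, mem_insert_iff, mem_sdiff]
    constructor
    · rintro (hx | hx | ⟨hx, _⟩)
      · exact hS₀E hx
      · rw [hx]; exact heE
      · exact hx
    · intro hx
      by_cases hxS : x ∈ M.closure X
      · exact Or.inl hxS
      · exact Or.inr (Or.inr ⟨hx, hxS⟩)
  have hR2 := encard_le_eRk_add_two_of_inter_singleton M hd hX4 h7 hR hinter hunion henl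
  -- the nullity of the restriction, as a natural number `d ≤ 2`
  obtain ⟨r, hr⟩ := exists_eRk_eq_coe M R
  have hrle : r ≤ R.ncard := by
    have := M.eRk_le_encard R
    rw [hr, ← hRf.cast_ncard_eq] at this
    exact_mod_cast this
  have hd2 : R.ncard - r ≤ 2 := by
    rw [hr, ← hRf.cast_ncard_eq] at hR2
    have : R.ncard ≤ r + 2 := by exact_mod_cast hR2
    omega
  haveI : (M ↾ R).Finite := ⟨hRf⟩
  have hdR : (M ↾ R).E.encard = (M ↾ R).eRank + (R.ncard - r : ℕ) := by
    rw [Matroid.restrict_ground_eq, Matroid.eRank_restrict, hr, ← hRf.cast_ncard_eq, ← Nat.cast_add]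
    congr 1
    omega
  have hsub : {C : Set α | M.IsCircuit C ∧ C.ncard = 5 ∧ e ∈ C ∧ C ∩ M.closure X ⊆ {e}} ⊆
      {C : Set α | (M ↾ R).IsCircuit C ∧ C.ncard = 5 ∧ e ∈ C} := by
    rintro C ⟨hC, h5, heC, hCS⟩
    refine ⟨(Matroid.restrict_isCircuit_iff hR).2 ⟨hC, ?_⟩, h5, heC⟩
    intro x hx
    by_cases hxS : x ∈ M.closure X
    · have := hCS ⟨hx, hxS⟩
      rw [mem_singleton_iff.1 this]
      exact mem_insert e _
    · exact mem_insert_of_mem _ ⟨hC.subset_ground hx, hxS⟩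
  have hfin : {C : Set α | (M ↾ R).IsCircuit C ∧ C.ncard = 5 ∧ e ∈ C}.Finite :=
    (M ↾ R).ground_finite.finite_subsets.subset (fun C hC => hC.1.subset_ground)
  calc {C : Set α | M.IsCircuit C ∧ C.ncard = 5 ∧ e ∈ C ∧ C ∩ M.closure X ⊆ {e}}.ncard
      ≤ {C : Set α | (M ↾ R).IsCircuit C ∧ C.ncard = 5 ∧ e ∈ C}.ncard := ncard_le_ncard hsub hfin
    _ ≤ ((R.ncard - r) + 3).choose 4 := ncard_fiveCircuitsThrough_le_choose (M ↾ R) hdR e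
    _ ≤ (2 + 3).choose 4 := Nat.choose_le_choose 4 (by omega)
    _ = 5 := by decide

/-- **The contraction by a 7-point rank-`4` flat has nullity `2` at nullity `5`**: `ν(M ／ S₀) = ν(M) − ν(S₀)` via the dual
(`dual_contract`, `eRk_dual_add_eRank`). -/
theorem nullity_contract_closure_eq_two (M : Matroid α) [M.Finite] (hd : M.E.encard = M.eRank + 5)
    {X : Set α} (hX4 : M.eRk X = 4) (h7 : (M.closure X).ncard = 7) :
    (M ／ M.closure X).E.encard = (M ／ M.closure X).eRank + 2 := by
  have hS₀E : M.closure X ⊆ M.E := M.closure_subset_ground X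
  have hS₀f : (M.closure X).Finite := M.ground_finite.subset hS₀E
  have hEf : M.E.Finite := M.ground_finite
  -- the dual rank of `E ∖ S₀` is `2`
  have hdual : M✶.eRk (M.E \ M.closure X) = 2 := by
    have h := M.eRk_dual_add_eRank (M.E \ M.closure X) sdiff_subset
    rw [sdiff_sdiff_cancel_left hS₀E, M.eRk_closure_eq, hX4] at h
    obtain ⟨rd, hrd⟩ := exists_eRk_eq_coe M✶ (M.E \ M.closure X)
    obtain ⟨rE, hrE⟩ := exists_eRk_eq_coe M M.E
    have hcard : (M.E \ M.closure X).ncard = M.E.ncard - 7 := by rw [ncard_sdiff' hS₀E hEf, h7]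
    have hd' : M.E.ncard = rE + 5 := by
      have h' := hd
      rw [M.eRank_def, hrE, ← hEf.cast_ncard_eq] at h'
      exact_mod_cast h'
    have h7' : 7 ≤ M.E.ncard := by
      have := ncard_le_ncard hS₀E hEf
      omega
    rw [hrd, M.eRank_def, hrE, ← (hEf.subset sdiff_subset).cast_ncard_eq, hcard] at h
    have h'' : rd + rE = 4 + (M.E.ncard - 7) := by exact_mod_cast h
    rw [hrd]
    have : rd = 2 := by omega
    rw [this]
    rfl
  have h := _root_.Matroid.eRank_add_eRank_dual (M ／ M.closure X)
  rw [Matroid.dual_contract, Matroid.delete_eq_restrict, Matroid.eRank_restrict, Matroid.dual_ground, hdual] at h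
  exact h.symm

end S1

end PercRepro
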